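import Summits.AnomalousDissipation.AnomalousDissipation.Theorems.BaireTransferRobustLoudUpgradeLine
import Summits.AnomalousDissipation.AnomalousDissipation.Theorems.BaireTransferRobustLoudUpgradeStubSteadyPersist
import Summits.AnomalousDissipation.AnomalousDissipation.Theorems.BaireTransferRobustLoudUpgradeStubSteadyWindow
import Literature.Analysis.FluidPDE.KolmogorovShearLinearised
import Literature.Analysis.FluidPDE.LongTimeAveragePeriodic
import Literature.Analysis.FunctionSpaces.TorusFourierModes
import Literature.Analysis.FunctionSpaces.TorusSpaceTime

/-!
# The laminar instance of the line `malkin-cone-group-orbits` (crux stmt-AnomalousDissipation-1144,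
# `BaireTransfer.RobustLoudUpgrade`): upgrade at the Kolmogorov point, at every Grashof number

Part A of the laminar instance (three registered sub-goals of the crux about the laminar — Kolmogorov /
shear — coefficient vector `cLam S A`, force `f = A sin(2πx₂) e₁`, the refuter's non-vacuity and tightness
witness of `Cruxes/RobustLoudUpgrade/Disproof.lean` §6, whose vocabulary `k₀, v₀, T₀, D, sh, cLam, Elam,
εlam` is restated here with identical bodies, together with its elementary facts):

* `kolmogorov_not_isLinNSEigenvalue` (registered sub-goal, G1) — the laminar steady state
  `sh r = r sin(2πx₂) e₁` has NO classical mean-zero kernel of its Navier–Stokes linearisation, at every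
  amplitude `r` and every viscosity `ν ≠ 0` (the Fourier telescoping argument of
  `Literature/Analysis/FluidPDE/KolmogorovShearLinearised.lean`,
  `KolmogorovShear.not_isLinNSEigenvalue_shear`, applied to the two-mode spectrum `{±k₀}` of `sh r`).

Part B (`BaireTransferRobustLoudUpgradeLaminarB.lean`) derives `upgradeAtLaminar` and
`sharpUpgradeAtLaminar` from G1 and the landed steady stubs.

References: Meshalkin–Sinai (1961); Temam, *Navier–Stokes Equations* (1979) Ch. II §1; the vocabulary
module `Theorems/BaireTransferRobustLoudUpgradeLine.lean`; patterns from
`Cruxes/RobustLoudUpgrade/Disproof.lean` §6.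
-/

-- `Summit.<Summit>.<Problem>` is the tree's mandated summit-side namespace (CONVENTIONS §2); for this
-- single-conjunct summit the two coincide, so the duplicate is deliberate.
set_option linter.dupNamespace false

noncomputable section

open scoped BigOperators Topology ENNReal ComplexConjugate
open Filter Set Function TopologicalSpace MeasureTheory UnitAddTorus

namespace Summit.AnomalousDissipation.AnomalousDissipation.Theorems.RobustLoudUpgrade.Laminar

open Literature.Analysis.FunctionSpaces Literature.Analysis.FunctionSpaces.Torus
open Literature.Analysis.FunctionSpaces.EuclideanSpace
open Literature.Analysis.FluidPDE
open Summit.AnomalousDissipation.AnomalousDissipation.Theses.BaireTransfer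

/-! ## §1 The laminar vocabulary (verbatim bodies of Cruxes/RobustLoudUpgrade/Disproof.lean §6) -/

/-- The gravest shear frequency `k₀ = (0,1,0)`. [folklore] -/
def k₀ : Fin 3 → ℤ := Pi.single 1 1

/-- The polarisation `v₀ = (−i, 0, 0) ⊥ k₀` (so that `Re (e_{k₀} • v₀) = sin(2πx₂) e₁`). [folklore] -/
def v₀ : EuclideanSpace ℂ (Fin 3) := WithLp.toLp 2 (Pi.single 0 (-Complex.I))

/-- The symmetric support `{k₀, −k₀}`. [folklore] -/
def T₀ : Finset (Fin 3 → ℤ) := {k₀, -k₀}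

/-- Conjugate-symmetric coefficient family of the shear field of amplitude `r`. [folklore] -/
def D (r : ℝ) : (Fin 3 → ℤ) → EuclideanSpace ℂ (Fin 3) := fun k =>
  if k = k₀ then ((r / 2 : ℝ) : ℂ) • v₀ else if k = -k₀ then ((r / 2 : ℝ) : ℂ) • conjVec v₀ else 0

/-- The laminar shear field `sh r = r sin(2πx₂) e₁` as a real trigonometric polynomial. [folklore] -/
def sh (r : ℝ) : UnitAddTorus (Fin 3) → EuclideanSpace ℝ (Fin 3) := realTrigPoly T₀ (D r)

/-- The laminar coefficient vector of amplitude `A` in any `P_S` with `k₀ ∈ S`. [folklore] -/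
def cLam (S : Finset (Fin 3 → ℤ)) (A : ℝ) : Coeff S := fun k => if (k : Fin 3 → ℤ) = k₀ then (A : ℂ) • v₀ else 0

/-- Laminar energy budget `E_lam = A²/(32π⁴ν²)`. [folklore] -/
def Elam (A ν : ℝ) : ℝ := (A / (4 * Real.pi ^ 2 * ν)) ^ 2 / 2

/-- Laminar dissipation budget `ε_lam = A²/(8π²ν)`. [folklore] -/
def εlam (A ν : ℝ) : ℝ := ν * (2 * Real.pi ^ 2 * (A / (4 * Real.pi ^ 2 * ν)) ^ 2)

/-! ## §2 Elementary facts (adapted from Cruxes/RobustLoudUpgrade/Disproof.lean §6) -/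

-- adapted from Cruxes/RobustLoudUpgrade/Disproof.lean §6
/-- Coordinates of `k₀`. [folklore] -/
theorem k₀_apply (i : Fin 3) : k₀ i = if i = 1 then 1 else 0 := by
  simp [k₀, Pi.single_apply]

-- adapted from Cruxes/RobustLoudUpgrade/Disproof.lean §6
/-- Coordinates of `v₀`. [folklore] -/
theorem v₀_apply (i : Fin 3) : v₀ i = if i = 0 then -Complex.I else 0 := by
  simp [v₀]

-- adapted from Cruxes/RobustLoudUpgrade/Disproof.lean §6
/-- `k₀ ≠ 0`. [folklore] -/
theorem k₀_ne_zero : k₀ ≠ 0 := by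
  intro h; have := congrFun h 1; simp [k₀] at this

-- adapted from Cruxes/RobustLoudUpgrade/Disproof.lean §6
/-- `−k₀ ≠ k₀`. [folklore] -/
theorem neg_k₀_ne : -k₀ ≠ k₀ := by
  intro h; have := congrFun h 1; simp [k₀] at this

-- adapted from Cruxes/RobustLoudUpgrade/Disproof.lean §6
/-- `|k₀|² = 1`. [folklore] -/
theorem freqNormSq_k₀ : freqNormSq k₀ = 1 := by
  simp [freqNormSq, k₀_apply]

-- adapted from Cruxes/RobustLoudUpgrade/Disproof.lean §6
/-- `k₀ · v₀ = 0`. [folklore] -/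
theorem sum_k₀_mul_v₀ : ∑ j, (k₀ j : ℂ) * v₀ j = 0 := by
  simp [k₀_apply, v₀_apply]

-- adapted from Cruxes/RobustLoudUpgrade/Disproof.lean §6
/-- `‖v₀‖ = 1`. [folklore] -/
theorem norm_v₀ : ‖v₀‖ = 1 := by
  rw [EuclideanSpace.norm_eq]
  simp [v₀_apply, Fin.sum_univ_three]

-- adapted from Cruxes/RobustLoudUpgrade/Disproof.lean §6
/-- `T₀` is symmetric. [folklore] -/
theorem T₀_symm : ∀ k ∈ T₀, -k ∈ T₀ := by
  intro k hk
  simp only [T₀, Finset.mem_insert, Finset.mem_singleton] at hk ⊢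
  rcases hk with rfl | rfl
  · exact Or.inr rfl
  · exact Or.inl (neg_neg _)

-- adapted from Cruxes/RobustLoudUpgrade/Disproof.lean §6
/-- `D r k₀ = (r/2) v₀`. [folklore] -/
theorem D_k₀ (r : ℝ) : D r k₀ = ((r / 2 : ℝ) : ℂ) • v₀ := by simp [D]

-- adapted from Cruxes/RobustLoudUpgrade/Disproof.lean §6
/-- `D r (−k₀) = (r/2) conj v₀`. [folklore] -/
theorem D_neg_k₀ (r : ℝ) : D r (-k₀) = ((r / 2 : ℝ) : ℂ) • conjVec v₀ := by
  simp [D, neg_k₀_ne]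

-- adapted from Cruxes/RobustLoudUpgrade/Disproof.lean §6
/-- `D r` vanishes off `{±k₀}`. [folklore] -/
theorem D_of_ne {r : ℝ} {k : Fin 3 → ℤ} (h1 : k ≠ k₀) (h2 : k ≠ -k₀) : D r k = 0 := by
  simp [D, h1, h2]

-- adapted from Cruxes/RobustLoudUpgrade/Disproof.lean §6
/-- `D r` is conjugate symmetric. [folklore] -/
theorem isConjSymm_D (r : ℝ) : IsConjSymm (D r) := by
  intro k
  by_cases h1 : k = k₀
  · subst h1
    rw [D_neg_k₀, D_k₀, conjVec_smul, Complex.conj_ofReal]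
  by_cases h2 : k = -k₀
  · subst h2
    rw [neg_neg, D_k₀, D_neg_k₀, conjVec_smul, Complex.conj_ofReal, conjVec_conjVec]
  · have h1' : -k ≠ k₀ := fun h => h2 (by rw [← h, neg_neg])
    have h2' : -k ≠ -k₀ := fun h => h1 (neg_injective h)
    rw [D_of_ne h1' h2', D_of_ne h1 h2, conjVec_zero]

-- adapted from Cruxes/RobustLoudUpgrade/Disproof.lean §6
/-- `D r` is transversal. [folklore] -/
theorem isTransversal_D (r : ℝ) : IsTransversal T₀ (D r) := by
  intro k hk
  simp only [T₀, Finset.mem_insert, Finset.mem_singleton] at hk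
  rcases hk with rfl | rfl
  · simp [D_k₀, k₀_apply, v₀_apply]
  · simp [D_neg_k₀, k₀_apply, v₀_apply, conjVec_apply]

-- adapted from Cruxes/RobustLoudUpgrade/Disproof.lean §6
/-- `sh r` is smooth. [folklore] -/
theorem isSmooth_sh (r : ℝ) : IsSmooth (sh r) := isSmooth_realTrigPoly _ _

-- adapted from Cruxes/RobustLoudUpgrade/Disproof.lean §6
/-- `sh r` is divergence free. [folklore] -/
theorem isDivFree_sh (r : ℝ) : IsDivFree (sh r) := isDivFree_realTrigPoly (isTransversal_D r)

-- adapted from Cruxes/RobustLoudUpgrade/Disproof.lean §6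
/-- `D r = r • D 1` coefficientwise. [folklore] -/
theorem D_eq_smul (r : ℝ) (k : Fin 3 → ℤ) : D r k = (r : ℂ) • D 1 k := by
  by_cases h1 : k = k₀
  · subst h1; rw [D_k₀, D_k₀, smul_smul]; push_cast; ring_nf
  by_cases h2 : k = -k₀
  · subst h2; rw [D_neg_k₀, D_neg_k₀, smul_smul]; push_cast; ring_nf
  · rw [D_of_ne h1 h2, D_of_ne h1 h2, smul_zero]

-- adapted from Cruxes/RobustLoudUpgrade/Disproof.lean §6
/-- `sh r x = r • sh 1 x`. [folklore] -/
theorem sh_apply (r : ℝ) (x : UnitAddTorus (Fin 3)) : sh r x = r • sh 1 x := by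
  ext i
  simp only [sh, realTrigPoly_apply_coord, trigPoly_apply_coord, PiLp.smul_apply, smul_eq_mul]
  simp_rw [D_eq_smul r, PiLp.smul_apply, smul_eq_mul]
  have hsum : (∑ k ∈ T₀, mFourier k x * ((r : ℂ) * D 1 k i)) = (r : ℂ) * ∑ k ∈ T₀, mFourier k x * D 1 k i := by
    rw [Finset.mul_sum]; exact Finset.sum_congr rfl fun k _ => by ring
  rw [hsum, Complex.re_ofReal_mul]

-- adapted from Cruxes/RobustLoudUpgrade/Disproof.lean §6
/-- The shear field is parallel to `e₁`. [folklore] -/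
theorem sh_apply_of_ne (r : ℝ) (x : UnitAddTorus (Fin 3)) {i : Fin 3} (hi : i ≠ 0) : sh r x i = 0 := by
  simp only [sh, realTrigPoly_apply_coord, trigPoly_apply_coord]
  rw [Finset.sum_eq_zero, Complex.zero_re]
  intro k hk
  simp only [T₀, Finset.mem_insert, Finset.mem_singleton] at hk
  rcases hk with rfl | rfl
  · simp [D_k₀, v₀_apply, hi]
  · simp [D_neg_k₀, v₀_apply, hi, conjVec_apply]

-- adapted from Cruxes/RobustLoudUpgrade/Disproof.lean §6
/-- `∂₁ sh = 0`. [folklore] -/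
theorem partialDeriv_zero_sh (r : ℝ) (x : UnitAddTorus (Fin 3)) : partialDeriv 0 (sh r) x = 0 := by
  rw [sh, partialDeriv_realTrigPoly]
  have h : realTrigPoly T₀ (fun k => (2 * Real.pi * Complex.I * (k (0 : Fin 3) : ℂ)) • D r k) =
      realTrigPoly T₀ 0 := by
    refine realTrigPoly_congr fun k hk => ?_
    simp only [T₀, Finset.mem_insert, Finset.mem_singleton] at hk
    rcases hk with rfl | rfl
    · simp [k₀]
    · simp [k₀]
  rw [h, realTrigPoly_zero]
  rfl

-- adapted from Cruxes/RobustLoudUpgrade/Disproof.lean §6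
/-- **No self-advection**: `(sh·∇) sh = 0`. [folklore] -/
theorem convect_sh (r : ℝ) (x : UnitAddTorus (Fin 3)) : Torus.convect (sh r) (sh r) x = 0 := by
  have hval : sh r x = (sh r x 0) • EuclideanSpace.single (0 : Fin 3) (1 : ℝ) := by
    ext i
    by_cases hi : i = 0
    · subst hi; simp
    · rw [sh_apply_of_ne r x hi]; simp [hi]
  unfold Torus.convect
  rw [hval, map_smul, ← partialDeriv_eq_fderiv_apply ((isSmooth_sh r).isContDiff (by simp)),
    partialDeriv_zero_sh, smul_zero]

-- adapted from Cruxes/RobustLoudUpgrade/Disproof.lean §6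
/-- The shear field is a Stokes eigenfield: `Δ sh = −4π² sh`. [folklore] -/
theorem laplacian_sh (r : ℝ) (x : UnitAddTorus (Fin 3)) : laplacian (sh r) x = -(4 * Real.pi ^ 2) • sh r x := by
  rw [sh, laplacian_realTrigPoly]
  have h : realTrigPoly T₀ (fun k => -(((4 * Real.pi ^ 2 * freqNormSq k : ℝ) : ℂ) • D r k)) =
      realTrigPoly T₀ (D (-(4 * Real.pi ^ 2) * r)) := by
    refine realTrigPoly_congr fun k hk => ?_
    have hk1 : freqNormSq k = 1 := by
      simp only [T₀, Finset.mem_insert, Finset.mem_singleton] at hk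
      rcases hk with rfl | rfl
      · exact freqNormSq_k₀
      · rw [freqNormSq_neg]; exact freqNormSq_k₀
    rw [hk1, mul_one, D_eq_smul (-(4 * Real.pi ^ 2) * r), D_eq_smul r, smul_smul, ← neg_smul]
    push_cast; ring_nf
  rw [h]
  change sh (-(4 * Real.pi ^ 2) * r) x = -(4 * Real.pi ^ 2) • sh r x
  rw [sh_apply, sh_apply r, smul_smul]

-- adapted from Cruxes/RobustLoudUpgrade/Disproof.lean §6
/-- `‖sh r‖₂² = r²/2`. [folklore] -/
theorem integral_norm_sq_sh (r : ℝ) : ∫ x, ‖sh r x‖ ^ 2 = r ^ 2 / 2 := by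
  rw [sh, integral_norm_sq_realTrigPoly T₀_symm (isConjSymm_D r)]
  have hT : T₀ = insert k₀ {-k₀} := rfl
  rw [hT, Finset.sum_insert (by simp [neg_k₀_ne.symm] : k₀ ∉ ({-k₀} : Finset (Fin 3 → ℤ))),
    Finset.sum_singleton, D_k₀, D_neg_k₀, norm_smul, norm_smul, norm_conjVec, norm_v₀,
    Complex.norm_real, Real.norm_eq_abs]
  rw [mul_one, ← sq_abs r]
  have : |r / 2| = |r| / 2 := by rw [abs_div, abs_two]
  rw [this]; ring

-- adapted from Cruxes/RobustLoudUpgrade/Disproof.lean §6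
/-- `‖∇ sh r‖₂² = 2π² r²`. [folklore] -/
theorem eGradNormSq_sh (r : ℝ) : eGradNormSq (sh r) = ENNReal.ofReal (2 * Real.pi ^ 2 * r ^ 2) := by
  rw [sh, eGradNormSq_realTrigPoly T₀_symm (isConjSymm_D r)]
  congr 1
  have hT : T₀ = insert k₀ {-k₀} := rfl
  rw [hT, Finset.sum_insert (by simp [neg_k₀_ne.symm] : k₀ ∉ ({-k₀} : Finset (Fin 3 → ℤ))),
    Finset.sum_singleton, D_k₀, D_neg_k₀, norm_smul, norm_smul, norm_conjVec, norm_v₀,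
    Complex.norm_real, Real.norm_eq_abs, freqNormSq_neg, freqNormSq_k₀]
  rw [mul_one, ← sq_abs r]
  have : |r / 2| = |r| / 2 := by rw [abs_div, abs_two]
  rw [this]; ring

variable {S : Finset (Fin 3 → ℤ)}

-- adapted from Cruxes/RobustLoudUpgrade/Disproof.lean §6 (`forceCoeff_cLam` + `force_cLam`)
/-- **`f_{cLam A} = sh A`**: the designer force of the laminar coefficient vector is the shear force. [folklore] -/
theorem force_cLam (hS : k₀ ∈ S) (A : ℝ) : force S (cLam S A) = sh A := by
  have hcoef : ∀ k, Torus.lerayCoeff k (coeffExt S (cLam S A) k) = if k = k₀ then (A : ℂ) • v₀ else 0 := by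
    intro k
    by_cases hk : k = k₀
    · subst hk
      rw [if_pos rfl, coeffExt_of_mem _ hS]
      have : cLam S A ⟨k₀, hS⟩ = (A : ℂ) • v₀ := by simp [cLam]
      rw [this, SteadyLattice.lerayCoeff_smul', Torus.lerayCoeff_of_ne_zero k₀_ne_zero,
        Torus.leraySym_of_transversal sum_k₀_mul_v₀]
    · rw [if_neg hk]
      have hz : coeffExt S (cLam S A) k = 0 := by
        by_cases hkS : k ∈ S
        · rw [coeffExt_of_mem _ hkS]; simp [cLam, hk]
        · exact coeffExt_of_not_mem _ hkS
      rw [hz, SteadyLattice.lerayCoeff_zero_vec]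
  funext x
  have hL : force S (cLam S A) x = realPart (mFourier k₀ x • ((A : ℂ) • v₀)) := by
    rw [force, realTrigPoly_apply]
    congr 1
    rw [trigPoly_apply, Finset.sum_eq_single_of_mem k₀ hS fun k _ hk => by rw [hcoef, if_neg hk, smul_zero]]
    rw [hcoef, if_pos rfl]
  have hR : sh A x = realPart (mFourier k₀ x • ((A : ℂ) • v₀)) := by
    rw [sh, realTrigPoly_apply, trigPoly_apply]
    have hT : T₀ = insert k₀ {-k₀} := rfl
    rw [hT, Finset.sum_insert (by simp [neg_k₀_ne.symm] : k₀ ∉ ({-k₀} : Finset (Fin 3 → ℤ))),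
      Finset.sum_singleton, D_k₀, D_neg_k₀, map_add]
    have hconj : mFourier (-k₀) x • (((A / 2 : ℝ) : ℂ) • conjVec v₀) =
        conjVec (mFourier k₀ x • (((A / 2 : ℝ) : ℂ) • v₀)) := by
      rw [conjVec_smul, conjVec_smul, Complex.conj_ofReal, mFourier_neg]
    rw [hconj, realPart_conjVec, ← two_smul ℝ, ← map_smul]
    congr 1
    ext i
    simp only [PiLp.smul_apply, smul_eq_mul, Complex.real_smul]
    push_cast; ring
  rw [hL, hR]

-- adapted from Cruxes/RobustLoudUpgrade/Disproof.lean §6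
/-- **The laminar steady state is a classical solution** of `NS_ν` forced by `f_{cLam A}`:
`u = sh (A/(4π²ν))`, `p = 0`. [folklore] -/
theorem lam_isClassical (hS : k₀ ∈ S) {ν : ℝ} (hν : ν ≠ 0) (A : ℝ) :
    IsClassicalNSSolutionOn Set.univ ν (fun _ => force S (cLam S A))
      (fun _ => sh (A / (4 * Real.pi ^ 2 * ν))) (fun _ _ => 0) where
  smooth_velocity := isSmoothSpaceTimeOn_const (isSmooth_sh _) _
  smooth_pressure := isSmoothSpaceTimeOn_const (isSmooth_const _) _
  momentum := fun t _ x => by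
    have h0 : Torus.timeDerivWithin Set.univ (fun _ : ℝ => sh (A / (4 * Real.pi ^ 2 * ν))) t x = 0 := by
      simp [Torus.timeDerivWithin]
    have hg : Torus.gradient (fun _ : UnitAddTorus (Fin 3) => (0 : ℝ)) x = 0 := by
      have : liftAt (fun _ : UnitAddTorus (Fin 3) => (0 : ℝ)) x = fun _ => 0 := rfl
      rw [Torus.gradient, this]
      exact gradient_fun_const 0 0
    rw [h0, convect_sh, laplacian_sh, hg, sub_zero, zero_add, force_cLam hS, sh_apply A,
      sh_apply (A / (4 * Real.pi ^ 2 * ν)), smul_smul, smul_smul, ← add_smul]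
    have : ν * -(4 * Real.pi ^ 2) * (A / (4 * Real.pi ^ 2 * ν)) + A = 0 := by
      field_simp; ring
    rw [this, zero_smul]
  divFree := fun _ _ => isDivFree_sh _

/-- The laminar steady state has zero mean (its force, hence itself, has no zero mode). [folklore] -/
theorem hasZeroMean_sh_lam (hS : k₀ ∈ S) (A ν : ℝ) : HasZeroMean (sh (A / (4 * Real.pi ^ 2 * ν))) := by
  rw [← force_cLam hS]
  exact SteadyPersist.hasZeroMean_force' _

-- adapted from Cruxes/RobustLoudUpgrade/Disproof.lean §6
/-- Mean energy of the steady laminar state: `⟨‖u‖₂²⟩ = r²/2`. [folklore] -/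
theorem meanEnergy_sh (r : ℝ) : meanEnergy (fun _ : ℝ => sh r) = r ^ 2 / 2 := by
  rw [meanEnergy_eq_of_periodic (τ := 1) (fun _ => rfl) one_pos]
  simp [integral_norm_sq_sh]

-- adapted from Cruxes/RobustLoudUpgrade/Disproof.lean §6
/-- Mean dissipation of the steady laminar state: `ν⟨‖∇u‖₂²⟩ = 2π²ν r²`. [folklore] -/
theorem meanDissipation_sh (ν r : ℝ) :
    meanDissipation ν (fun _ : ℝ => sh r) = ν * (2 * Real.pi ^ 2 * r ^ 2) := by
  rw [meanDissipation_eq_of_periodic (τ := 1) (fun _ => rfl) one_pos]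
  simp [eGradNormSq_sh, ENNReal.toReal_ofReal (by positivity : (0 : ℝ) ≤ 2 * Real.pi ^ 2 * r ^ 2)]

-- adapted from Cruxes/RobustLoudUpgrade/Disproof.lean §6
/-- `cLam` is linear in the amplitude. [folklore] -/
theorem cLam_smul (θ A : ℝ) : cLam S (θ * A) = θ • cLam S A := by
  funext k
  simp only [cLam, Pi.smul_apply]
  split_ifs
  · rw [Complex.ofReal_mul, mul_smul, Complex.coe_smul]
  · rw [smul_zero]

/-! ## §3 (G1) The laminar state has no classical kernel: `kolmogorov_not_isLinNSEigenvalue` -/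

/-- The Fourier coefficients of the shear field: `𝓕(sh r)(m) = D r m` (supported on `{±k₀}`). [folklore] -/
theorem mFourierCoeff_sh (r : ℝ) (m : Fin 3 → ℤ) :
    mFourierCoeff (complexify ∘ sh r) m = D r m := by
  rw [sh, mFourierCoeff_realTrigPoly T₀_symm (isConjSymm_D r)]
  split_ifs with hm
  · rfl
  · simp only [T₀, Finset.mem_insert, Finset.mem_singleton, not_or] at hm
    rw [D_of_ne hm.1 hm.2]

/-- **(G1) The Kolmogorov shear state has no neutral steady mode**: for every amplitude `r` and every
`ν ≠ 0`, the classical linearisation of `NS_ν` at `sh r = r sin(2πx₂) e₁` has no mean-zero kernel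
(`KolmogorovShear.not_isLinNSEigenvalue_shear`: Fourier support `{±k₀}`, values parallel to `e₁`). [folklore] -/
theorem kolmogorov_not_isLinNSEigenvalue : ∀ (ν r : ℝ), ν ≠ 0 → ¬ Torus.IsLinNSEigenvalue ν (sh r) 0 := by
  intro ν r hν
  refine KolmogorovShear.not_isLinNSEigenvalue_shear hν (isSmooth_sh r) (fun m h1 h2 => ?_) (fun m j hj => ?_)
  · rw [mFourierCoeff_sh]
    exact D_of_ne h1 h2
  · rw [mFourierCoeff_sh, D]
    dsimp only
    split_ifs <;> simp [v₀_apply, conjVec_apply, hj]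

end Summit.AnomalousDissipation.AnomalousDissipation.Theorems.RobustLoudUpgrade.Laminar

end
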